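import Literature.Barriers.AtomisticToContinuum.StickySphereClustersProofs
import Literature.MathematicalPhysics.StatisticalMechanics.Crystallization
import HarnessLib

/-!
# Narrowed barrier `StickySphereClustersNarrow` (barrier audit of `StickySphereClusters`, 2026-08-15)

`Literature/Barriers/AtomisticToContinuum/` (D-0021 barrier catalogue), sub-problem
`Crystallization`. Companion of `StickySphereClusters.lean` (six sticky balls: the octahedron and
the capped trigonal bipyramid tie at twelve contacts; typed statement `StickySphereClusters`,
PROVED there as `StickySphereClusters_holds`) and of `StickySphereClustersProofs.lean`, which
DISCHARGES the enumeration fact `ArkusHoy_sixSpheres` (`ArkusHoy_sixSpheres_holds`: among six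
distinct points of `ℝ³` at most `12` pairs are at distance `2`, with equality only for the two
macrostates; its packing and three-contact hypotheses are not used). The typed parent is a theorem
and cannot be refuted; this audit is about what it BLOCKS. (The parent's `scope_caveats` line
"NOT proved here: that `12` is maximal … (named fact `ArkusHoy_sixSpheres` …)" predates the
discharge.)

**Audit (refuter, 2026-08-15).** Re-read at page level (texts materialised with `lit read`):
Arkus–Manoharan–Brenner 2009, pp. 2–3; Hoy–Harwayne-Gidansky–O'Hern 2012 (arXiv:1202.5208, whose
section numbering is used below), §2, §3 with §3.1–3.3, §4, §5, App. 7–9; Holmes-Cerfon 2016 (arXiv:1407.3285), §1 (iii),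
§3 "Hyperstatic clusters / Ground states", SI §7.5; Bezdek 2012 (arXiv:1102.1198), §1 and
Theorem 1.1; Flatley–Theil 2015 (arXiv:1407.0692), Theorem 1.1, the remark after it (p. 4), §2.1
with Conjecture 2.2, §3.1 Proposition 3.3 and Theorems 3.4–3.5; Blanc–Lewin 2015, §2.3;
De Luca–Friesecke 2017, §1 and Theorem 5.1; in the tree `FejesTothKissingTwelve.lean` (Hales 2012,
Theorem 1), `KissingTwelveDegeneracy.lean`, `FlexibleKissingArrangements.lean` (with its
`…Narrow`), `IcosahedralClusters.lean` (with its `…Narrow`), `TetrahedralFrustration.lean`.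
Verdict: NARROWED, on four counts.

1. TWO HALVES, ONLY ONE FAILS. The two-dimensional theorem being transplanted says "For any number
   `N` of particles, minimizing configurations … of the Heitmann–Radin energy … are, up to an
   overall rotation and translation, subsets of the triangular lattice"
   [cite: LucaFriesecke2016, Theorem 5.1] [cite: HeitmannRadin1980, Theorem]. It has an ENERGY
   half (the minimum is attained by a lattice fragment) and a STRUCTURE half (every minimiser is
   one). At six balls in `ℝ³` only the structure half fails: the regular octahedron — the
   octahedral interstice of both fcc and hcp, a Barlow motif — attains the maximal contact number
   `12` among ALL packings of six unit balls, and the maximisers are exactly the octahedron and the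
   capped trigonal bipyramid (clause (2) below, from the discharged enumeration). The energy half
   agrees with every enumeration in print: "Up to `n = 9` every packing has exactly `3n - 6`
   contacts" (so the capped octahedra, fcc fragments, are among the ground states), at `n = 10`
   "there exist 3 such packings [with `25`] … these special packings are all subunits of the
   hexagonally close-packed lattice", with hcp continuations of `29` and `33` contacts at
   `n = 11, 12` [cite: ArkusManoharanBrenner2009, p. 2]; "The unique sticky hard sphere ground
   state [for `N = 11`] has `N_c = 29` and HCP order" [cite: HoyHarwayneGidanskyOHern2012, §3.1];
   the hcp and fcc kissing clusters "are the left-most ground states for `n = 13`"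
   [cite: HolmesCerfon2016, §3]; and for `13 ≤ n ≤ 19` the centred cuboctahedron with `k` of its
   square faces capped — an fcc fragment, typed below as `fccNucleus k` and PROVED to be a
   unit-ball packing with `36 + 4k` contacts (clause (3)) — attains `36, 40, 44, 48, 52, 56, 60`,
   the maxima reported by the ground-state search ("`M(n) = ⌈lower bound⌉ + 1` for
   `6 ≤ n ≤ 19`, (except `n = 12` where the correction is `2`)", lower bound `6n - 7.862 n^{2/3}`)
   [cite: HolmesCerfon2016, SI §7.5]. No `n` is known at which every maximiser is non-Barlow.
   Routes that use the sticky limit only through the VALUE `C(n)` of the maximal contact number,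
   or through the existence of a close-packed maximiser, are therefore not met by this barrier.
   (Rigorously `C(n)` is settled only for very small `n` — here `C(6) = 12`; "Whether in any of the
   inequalities `C(10) ≥ 25, C(11) ≥ 29, C(12) ≥ 33`, and `C(13) ≥ 36` we have equality is a
   challenging open question", and `6n - ∛486 n^{2/3} < C_fcc(n) ≤ C(n) < 6n - 0.695 n^{2/3}`
   [cite: Bezdek2011, §1 and Theorem 1.1]; the enumerations beyond `n = 6` are computer
   enumerations, "we have no proof these sets are complete" [cite: HolmesCerfon2016, §1].)
2. NOT A SMALL-`n` WINDOW EITHER WAY (sharpening the parent's evasion (i)). All maximisers are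
   close-packing fragments at `n = 10, 11` [cite: ArkusManoharanBrenner2009, p. 2]
   [cite: HoyHarwayneGidanskyOHern2012, §3.1] and at `n = 17, 18` [cite: HolmesCerfon2016, §3],
   but non-close-packed maximisers RECUR: at `n = 7` two of the `M_c = 15` "seven-sphere minimal
   energy packings" are five-fold, "incompatible with close-packed crystal structure", and among
   isostatic packings — which ARE the ground states for `N ≤ 9` — "`f_Barlow` decreases rapidly
   for `N ≥ 7`" [cite: HoyHarwayneGidanskyOHern2012, §3 and §3.2]; at `n = 13` there are "six
   other clusters with the same number of contacts, three of which have defects", and "for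
   `n = 15, 16, 19` there is one ground state with a defect" [cite: HolmesCerfon2016, §3]. So the
   structure half is obstructed at `n = 6–9, 13, 15, 16, 19` on present data, not only at six;
   whether the maximisers are EVENTUALLY all Barlow (`∃ N₀ ∀ n ≥ N₀`) is open ("The ground states
   appear to converge rapidly to close-packings" [cite: HolmesCerfon2016, §3]; "We have not yet
   established whether the ground states continue to be commensurate with a lattice packing for
   `n > 12`" [cite: ArkusManoharanBrenner2009, p. 3]).
3. THE TECHNIQUE CLASS IS TOO WIDE. The `d = 3` work that actually transplants the two-dimensional
   method never classifies finite clusters. Theil's local step becomes: if a point has `12`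
   neighbours realising `24` neighbour–neighbour contacts then its neighbourhood is the
   cuboctahedron or the twisted cuboctahedron up to `ε(α)` [cite: FlatleyTheil2015, Proposition 3.3],
   resting on the kissing number [cite: FlatleyTheil2015, Theorem 3.4] and on "the maximal number
   of undirected … edges in the contact graph `CG(Z)` … is `24`. Equality is attained only when the
   points of `Z` are placed at the vertices of a cuboctahedron or a twisted cuboctahedron"
   [cite: FlatleyTheil2015, Theorem 3.5] [cite: FlatleyEtAl2013, Theorem]; fcc crystallization
   follows for `α`-localized pair-plus-three-body potentials [cite: FlatleyTheil2015, Theorem 1.1],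
   "The role of the three-body potential `V₃` is of solely a technical nature. It is quite likely
   that the assumptions of Theorem 1.1 can be relaxed so that also pure pair models are covered"
   [cite: FlatleyTheil2015, remark after Theorem 1.1 (p. 4)], and the proposed way to drop `V₃` is
   again LOCAL [cite: FlatleyTheil2015, Conjecture 2.2]. The infinite-volume sticky structure
   theorem in `d = 3` is Hales's kissing-twelve theorem (tree:
   `Literature.Geometry.DiscreteGeometry.Hales2012_kissingTwelve`, `…FejesTothKissingTwelve`
   [cite: Hales2012, Theorem 1]): a packing in which every ball touches twelve others is a stacking
   of hexagonal layers. None of this is touched by any finite-`n` degeneracy: contact maximisation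
   PER SHELL is alive; only contact maximisation PER CLUSTER, read as "classify all maximisers for
   every `n`", is blocked. The genuine `d = 3` obstructions to the local programme are catalogued
   separately — `KissingTwelveDegeneracy` (twelve contacts never select the stacking),
   `FlexibleKissingArrangements`/`…Narrow` (count-only shell rigidity fails for soft wells),
   `IcosahedralClusters`/`…Narrow` (`LJ₁₃`) — and the review's summary stands: for the sticky
   potential "one obtains … either FCC or the other sphere packing solutions in 3D", while for
   realistic potentials the problem is "completely open in dimension three"
   [cite: BlancLewin2015, §2.3].
4. THE TIE IS EXACTLY STICKY (clause (4), proved). For EVERY pair potential `V` the two six-ball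
   clusters have energies `12 V(2) + 3 V(2√2)` (octahedron) and
   `12 V(2) + 2 V(2√(8/3)) + V(10/3)` (capped bipyramid): any `V` strictly increasing on
   `[2, ∞)` — an attractive tail beyond contact, as in Radin's soft discs ("non-decreasing for
   `r ≥ 1`" [cite: BlancLewin2015, §2.3]), Theil's wells, or Lennard-Jones at the contact scale
   `r ↦ V_LJ(r/2)` — makes the octahedron STRICTLY better; any strictly decreasing one (a repulsive
   shoulder) selects the capped bipyramid; only a tail vanishing beyond contact ties them. So
   `brittle-limit-perturbation` is not blocked at `N = 6`: the perturbation lifts the degeneracy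
   toward the Barlow motif. What soft wells spoil at small `N` is five-fold order (`N = 7`
   pentagonal bipyramid, `N = 13` icosahedron — `IcosahedralClusters`), a different barrier.
5. (Wording.) The parent's `blocks:` line quotes "nearly 95% for `N = 11`": that is the fraction
   of ISOSTATIC (`N_c = 27`) nuclei, which at `N = 11` are second excited states; the ground state
   there is unique and hcp [cite: HoyHarwayneGidanskyOHern2012, §3.1 and §5]. Zero-temperature
   routes should not be charged with it.

Contents: the pair-sum form of `interactionEnergy` and the energies of `octahedralSix`,
`cappedBipyramidSix` for an arbitrary pair potential (`interactionEnergy_octahedralSix`,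
`interactionEnergy_cappedBipyramidSix`); the tie-breaking theorems
(`interactionEnergy_octahedralSix_lt`, `interactionEnergy_cappedBipyramidSix_lt`,
`interactionEnergy_eq_of_zero_tail`, and for Lennard-Jones `strictMonoOn_lennardJones`,
`interactionEnergy_lennardJones_octahedralSix_lt`); the energy half at six balls
(`contactNumber_le_octahedralSix`, from `ArkusHoy_sixSpheres_holds`); the fcc nuclei
`fccNucleus k` (`13 ≤ n ≤ 19`) with `fccNucleus_packing_contacts`; the entry
`StickySphereClustersNarrow` with its BARRIER block, proved (`stickySphereClustersNarrow_holds`,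
axioms `propext`, `Classical.choice`, `Quot.sound`). NOT here: maximality of `36 + 4k`
(enumeration, cited), the non-Barlow maximisers at `n ≥ 7` (enumerations, cited), embeddability
questions in Barlow stackings (parent caveat stands).

## References

* [ArkusManoharanBrenner2009] N. Arkus, V. N. Manoharan, M. P. Brenner, Phys. Rev. Lett. 103
  (2009) 118303: pp. 2–3.
* [HoyHarwayneGidanskyOHern2012] R. S. Hoy, J. Harwayne-Gidansky, C. S. O'Hern, Phys. Rev. E 85
  (2012) 051403, arXiv:1202.5208 (arXiv section numbering): §2 (p. 4), §3 (opening), §3.1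
  (the `N = 11` ground state), §3.2 (stack-faulted and five-fold motifs), §3.3, §5.
* [HolmesCerfon2016] M. Holmes-Cerfon, SIAM Rev. 58 (2016) 229–244, arXiv:1407.3285: §1 (iii),
  §3 ("Hyperstatic clusters / Ground states"), SI §7.5 (Table with `M(n)`, `6 ≤ n ≤ 19`).
* [Bezdek2011] K. Bezdek, Discrete Comput. Geom. 48 (2012) 298–309, arXiv:1102.1198: §1,
  Theorem 1.1 (i), (iii).
* [FlatleyTheil2015] L. Flatley, F. Theil, Arch. Ration. Mech. Anal. 218 (2015) 363–416,
  arXiv:1407.0692: Theorem 1.1 and p. 4; Conjecture 2.2; Proposition 3.3, Theorems 3.4–3.5.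
* [FlatleyEtAl2013] L. Flatley, A. Tarasov, M. Taylor, F. Theil, J. Comput. Appl. Math. 254
  (2013) 220–225 (= Theorem 3.5 of the above; not re-read separately).
* [Hales2012] T. C. Hales, arXiv:1209.6043, Theorem 1 (tree: `FejesTothKissingTwelve.lean`).
* [BlancLewin2015] X. Blanc, M. Lewin, EMS Surv. Math. Sci. 2 (2015), arXiv:1504.01153: §2.3.
* [LucaFriesecke2016] L. De Luca, G. Friesecke, J. Nonlinear Sci. (2017), arXiv:1605.00034: §1,
  Theorem 5.1.
* [HeitmannRadin1980] R. C. Heitmann, C. Radin, J. Stat. Phys. 22 (1980) 281 (through the above).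
-/

noncomputable section

open Finset

namespace Literature.Barriers.AtomisticToContinuum

/-- Euclidean `3`-space. -/
local notation "E3" => EuclideanSpace ℝ (Fin 3)

open AtomisticToContinuum (intConfig dist_intConfig)
open Literature.Geometry.DiscreteGeometry (sqNormInt IsUnitBallPacking)
open Literature.MathematicalPhysics.StatisticalMechanics (interactionEnergy lennardJones)

/-! ### Energies of the two six-ball clusters for an arbitrary pair potential -/

/-- Pair-sum form of the interaction energy: `𝓔(x) = ∑_{i<j} V(|xᵢ - xⱼ|)` as a sum over the
ordered pairs `i < j`. [cite: BlancLewin2015, §1.1 (1)] -/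
theorem interactionEnergy_eq_sum_pairs (V : ℝ → ℝ) {d N : ℕ} (x : Fin N → EuclideanSpace ℝ (Fin d)) :
    interactionEnergy V x =
      ∑ p ∈ (univ : Finset (Fin N × Fin N)).filter (fun p => p.1 < p.2), V (dist (x p.1) (x p.2)) := by
  unfold Literature.MathematicalPhysics.StatisticalMechanics.interactionEnergy
  rw [Finset.sum_filter, ← Finset.univ_product_univ, Finset.sum_product]
  refine Finset.sum_congr rfl fun i _ => ?_
  rw [← Finset.sum_filter, Finset.filter_lt_eq_Ioi]

/-- Pair classes of the octahedron: `12` pairs at squared distance `162`, `3` at `324`.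
[folklore] -/
theorem sum_pairs_octa (f : ℤ → ℝ) :
    ∑ p ∈ (univ : Finset (Fin 6 × Fin 6)).filter (fun p => p.1 < p.2),
        f (sqNormInt (octaInt p.1 - octaInt p.2)) = 12 * f 162 + 3 * f 324 := by
  set S := (univ : Finset (Fin 6 × Fin 6)).filter (fun p => p.1 < p.2) with hS
  rw [← Finset.sum_filter_add_sum_filter_not S (fun p => sqNormInt (octaInt p.1 - octaInt p.2) = 162)]
  have key : ∀ q : Fin 6 × Fin 6, q.1 < q.2 → sqNormInt (octaInt q.1 - octaInt q.2) ≠ 162 →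
      sqNormInt (octaInt q.1 - octaInt q.2) = 324 := by decide +kernel
  have hA : ∀ p ∈ S.filter (fun p => sqNormInt (octaInt p.1 - octaInt p.2) = 162),
      f (sqNormInt (octaInt p.1 - octaInt p.2)) = f 162 := fun p hp => by
    rw [(Finset.mem_filter.1 hp).2]
  have hB : ∀ p ∈ S.filter (fun p => ¬ sqNormInt (octaInt p.1 - octaInt p.2) = 162),
      f (sqNormInt (octaInt p.1 - octaInt p.2)) = f 324 := fun p hp => by
    obtain ⟨hpS, hne⟩ := Finset.mem_filter.1 hp
    rw [key p (by rw [hS] at hpS; exact (Finset.mem_filter.1 hpS).2) hne]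
  rw [Finset.sum_congr rfl hA, Finset.sum_congr rfl hB, Finset.sum_const, Finset.sum_const]
  have cA : (S.filter (fun p => sqNormInt (octaInt p.1 - octaInt p.2) = 162)).card = 12 := by
    rw [hS]; decide +kernel
  have cB : (S.filter (fun p => ¬ sqNormInt (octaInt p.1 - octaInt p.2) = 162)).card = 3 := by
    rw [hS]; decide +kernel
  rw [cA, cB, nsmul_eq_mul, nsmul_eq_mul]
  push_cast
  ring

/-- Pair classes of the capped trigonal bipyramid: `12` pairs at squared distance `162`, `2` at
`432`, `1` at `450`. [folklore] -/
theorem sum_pairs_ctb (f : ℤ → ℝ) :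
    ∑ p ∈ (univ : Finset (Fin 6 × Fin 6)).filter (fun p => p.1 < p.2),
        f (sqNormInt (ctbInt p.1 - ctbInt p.2)) = 12 * f 162 + 2 * f 432 + f 450 := by
  set S := (univ : Finset (Fin 6 × Fin 6)).filter (fun p => p.1 < p.2) with hS
  rw [← Finset.sum_filter_add_sum_filter_not S (fun p => sqNormInt (ctbInt p.1 - ctbInt p.2) = 162)]
  set T := S.filter (fun p => ¬ sqNormInt (ctbInt p.1 - ctbInt p.2) = 162) with hT
  rw [← Finset.sum_filter_add_sum_filter_not T (fun p => sqNormInt (ctbInt p.1 - ctbInt p.2) = 432)]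
  have key : ∀ q : Fin 6 × Fin 6, q.1 < q.2 → sqNormInt (ctbInt q.1 - ctbInt q.2) ≠ 162 →
      sqNormInt (ctbInt q.1 - ctbInt q.2) ≠ 432 → sqNormInt (ctbInt q.1 - ctbInt q.2) = 450 := by
    decide +kernel
  have hA : ∀ p ∈ S.filter (fun p => sqNormInt (ctbInt p.1 - ctbInt p.2) = 162),
      f (sqNormInt (ctbInt p.1 - ctbInt p.2)) = f 162 := fun p hp => by
    rw [(Finset.mem_filter.1 hp).2]
  have hB : ∀ p ∈ T.filter (fun p => sqNormInt (ctbInt p.1 - ctbInt p.2) = 432),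
      f (sqNormInt (ctbInt p.1 - ctbInt p.2)) = f 432 := fun p hp => by
    rw [(Finset.mem_filter.1 hp).2]
  have hC : ∀ p ∈ T.filter (fun p => ¬ sqNormInt (ctbInt p.1 - ctbInt p.2) = 432),
      f (sqNormInt (ctbInt p.1 - ctbInt p.2)) = f 450 := fun p hp => by
    obtain ⟨hpT, hne⟩ := Finset.mem_filter.1 hp
    rw [hT] at hpT
    obtain ⟨hpS, hne'⟩ := Finset.mem_filter.1 hpT
    rw [hS] at hpS
    rw [key p (Finset.mem_filter.1 hpS).2 hne' hne]
  rw [Finset.sum_congr rfl hA, Finset.sum_congr rfl hB, Finset.sum_congr rfl hC, Finset.sum_const,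
    Finset.sum_const, Finset.sum_const]
  have cA : (S.filter (fun p => sqNormInt (ctbInt p.1 - ctbInt p.2) = 162)).card = 12 := by
    rw [hS]; decide +kernel
  have cB : (T.filter (fun p => sqNormInt (ctbInt p.1 - ctbInt p.2) = 432)).card = 2 := by
    rw [hT, hS]; decide +kernel
  have cC : (T.filter (fun p => ¬ sqNormInt (ctbInt p.1 - ctbInt p.2) = 432)).card = 1 := by
    rw [hT, hS]; decide +kernel
  rw [cA, cB, cC, nsmul_eq_mul, nsmul_eq_mul, nsmul_eq_mul]
  push_cast
  ring

/-- **Energy of the octahedron** for an arbitrary pair potential: `12 V(2) + 3 V(2√2)` (twelve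
contacts, three antipodal pairs). [folklore] -/
theorem interactionEnergy_octahedralSix (V : ℝ → ℝ) :
    interactionEnergy V octahedralSix = 12 * V 2 + 3 * V (2 * Real.sqrt 2) := by
  rw [interactionEnergy_eq_sum_pairs]
  simp only [octahedralSix, dist_intConfig_sqrt octaInt (by norm_num : 0 < 162)]
  rw [sum_pairs_octa (fun n : ℤ => V (2 * Real.sqrt ((n : ℝ) / ((162 : ℕ) : ℝ))))]
  norm_num

/-- **Energy of the capped trigonal bipyramid** for an arbitrary pair potential:
`12 V(2) + 2 V(2√(8/3)) + V(10/3)` (twelve contacts, the two cap–far-vertex pairs, the cap–cap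
pair). [folklore] -/
theorem interactionEnergy_cappedBipyramidSix (V : ℝ → ℝ) :
    interactionEnergy V cappedBipyramidSix =
      12 * V 2 + 2 * V (2 * Real.sqrt (8 / 3)) + V (10 / 3) := by
  rw [interactionEnergy_eq_sum_pairs]
  simp only [cappedBipyramidSix, dist_intConfig_sqrt ctbInt (by norm_num : 0 < 162)]
  rw [sum_pairs_ctb (fun n : ℤ => V (2 * Real.sqrt ((n : ℝ) / ((162 : ℕ) : ℝ))))]
  have h25 : Real.sqrt (25 : ℝ) = 5 := by
    rw [show (25 : ℝ) = 5 ^ 2 by norm_num, Real.sqrt_sq (by norm_num)]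
  have h9 : Real.sqrt (9 : ℝ) = 3 := by
    rw [show (9 : ℝ) = 3 ^ 2 by norm_num, Real.sqrt_sq (by norm_num)]
  norm_num [h25, h9]

/-! ### The tie is exactly sticky: any monotone tail breaks it -/

/-- `2 ≤ 2√2`. [folklore] -/
theorem two_le_two_mul_sqrt_two : (2 : ℝ) ≤ 2 * Real.sqrt 2 := by
  have h : (1 : ℝ) ≤ Real.sqrt 2 := by
    rw [show (1 : ℝ) = Real.sqrt 1 from Real.sqrt_one.symm]
    exact Real.sqrt_le_sqrt (by norm_num)
  linarith

/-- `2√2 < 2√(8/3)` (`2.83 < 3.27`). [folklore] -/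
theorem two_mul_sqrt_two_lt_sqrt_eight_thirds : 2 * Real.sqrt 2 < 2 * Real.sqrt (8 / 3) := by
  have h : Real.sqrt 2 < Real.sqrt (8 / 3) := Real.sqrt_lt_sqrt (by norm_num) (by norm_num)
  linarith

/-- `2√2 < 10/3` (`2.83 < 3.33`). [folklore] -/
theorem two_mul_sqrt_two_lt_ten_thirds : 2 * Real.sqrt 2 < 10 / 3 := by
  have h : Real.sqrt 2 < 5 / 3 := by
    rw [Real.sqrt_lt' (by norm_num)]; norm_num
  linarith

/-- **Any potential strictly increasing beyond contact selects the octahedron** (the Barlow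
motif): `𝓔(octahedron) < 𝓔(capped bipyramid)`. [folklore] -/
theorem interactionEnergy_octahedralSix_lt (V : ℝ → ℝ) (hV : StrictMonoOn V (Set.Ici 2)) :
    interactionEnergy V octahedralSix < interactionEnergy V cappedBipyramidSix := by
  rw [interactionEnergy_octahedralSix, interactionEnergy_cappedBipyramidSix]
  have h0 : (2 : ℝ) ≤ 2 * Real.sqrt 2 := two_le_two_mul_sqrt_two
  have h1 : V (2 * Real.sqrt 2) < V (2 * Real.sqrt (8 / 3)) :=
    hV h0 (le_of_lt (lt_of_le_of_lt h0 two_mul_sqrt_two_lt_sqrt_eight_thirds))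
      two_mul_sqrt_two_lt_sqrt_eight_thirds
  have h2 : V (2 * Real.sqrt 2) < V (10 / 3) :=
    hV h0 (le_of_lt (lt_of_le_of_lt h0 two_mul_sqrt_two_lt_ten_thirds)) two_mul_sqrt_two_lt_ten_thirds
  linarith

/-- **Any potential strictly decreasing beyond contact selects the capped trigonal bipyramid**
(the non-Barlow cluster). [folklore] -/
theorem interactionEnergy_cappedBipyramidSix_lt (V : ℝ → ℝ) (hV : StrictAntiOn V (Set.Ici 2)) :
    interactionEnergy V cappedBipyramidSix < interactionEnergy V octahedralSix := by
  rw [interactionEnergy_octahedralSix, interactionEnergy_cappedBipyramidSix]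
  have h0 : (2 : ℝ) ≤ 2 * Real.sqrt 2 := two_le_two_mul_sqrt_two
  have h1 : V (2 * Real.sqrt (8 / 3)) < V (2 * Real.sqrt 2) :=
    hV h0 (le_of_lt (lt_of_le_of_lt h0 two_mul_sqrt_two_lt_sqrt_eight_thirds))
      two_mul_sqrt_two_lt_sqrt_eight_thirds
  have h2 : V (10 / 3) < V (2 * Real.sqrt 2) :=
    hV h0 (le_of_lt (lt_of_le_of_lt h0 two_mul_sqrt_two_lt_ten_thirds)) two_mul_sqrt_two_lt_ten_thirds
  linarith

/-- **A potential vanishing beyond contact ties them** — the exactly sticky case (both energies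
are `12 V(2)`). [cite: ArkusManoharanBrenner2009, p. 1] -/
theorem interactionEnergy_eq_of_zero_tail (V : ℝ → ℝ) (hV : ∀ r : ℝ, 2 < r → V r = 0) :
    interactionEnergy V octahedralSix = interactionEnergy V cappedBipyramidSix := by
  rw [interactionEnergy_octahedralSix, interactionEnergy_cappedBipyramidSix,
    hV _ (lt_of_le_of_lt two_le_two_mul_sqrt_two two_mul_sqrt_two_lt_sqrt_eight_thirds),
    hV _ (lt_of_le_of_lt two_le_two_mul_sqrt_two two_mul_sqrt_two_lt_ten_thirds),
    hV (2 * Real.sqrt 2) ?_]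
  · ring
  · have h : (1 : ℝ) < Real.sqrt 2 := by
      rw [show (1 : ℝ) = Real.sqrt 1 from Real.sqrt_one.symm]
      exact Real.sqrt_lt_sqrt (by norm_num) (by norm_num)
    linarith

/-- The Lennard-Jones potential `r⁻¹²/12 - r⁻⁶/6` is strictly increasing on `[1, ∞)` (beyond its
minimum). [cite: BlancLewin2015, §1.1 (3)] -/
theorem strictMonoOn_lennardJones : StrictMonoOn lennardJones (Set.Ici 1) := by
  intro a ha b hb hab
  simp only [Set.mem_Ici] at ha hb
  unfold Literature.MathematicalPhysics.StatisticalMechanics.lennardJones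
  have ha0 : 0 < a := by linarith
  have hb0 : 0 < b := by linarith
  set u : ℝ := (a⁻¹) ^ 6 with hu
  set v : ℝ := (b⁻¹) ^ 6 with hv
  have hu1 : u ≤ 1 := by
    rw [hu, inv_pow]; exact inv_le_one_of_one_le₀ (one_le_pow₀ ha)
  have hvu : v < u := by
    rw [hu, hv]
    apply pow_lt_pow_left₀ _ (by positivity) (by norm_num)
    exact (inv_lt_inv₀ hb0 ha0).2 hab
  have hv0 : 0 < v := by positivity
  have e1 : (a⁻¹) ^ 12 = u ^ 2 := by rw [hu, ← pow_mul]
  have e2 : (b⁻¹) ^ 12 = v ^ 2 := by rw [hv, ← pow_mul]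
  rw [e1, e2]
  nlinarith

/-- Lennard-Jones at the contact scale (equilibrium distance `2`) is strictly increasing on
`[2, ∞)`. [folklore] -/
theorem strictMonoOn_lennardJones_half :
    StrictMonoOn (fun r : ℝ => lennardJones (r / 2)) (Set.Ici 2) := by
  intro a ha b hb hab
  simp only [Set.mem_Ici] at ha hb
  exact strictMonoOn_lennardJones (show a / 2 ∈ Set.Ici (1 : ℝ) from Set.mem_Ici.2 (by linarith))
    (show b / 2 ∈ Set.Ici (1 : ℝ) from Set.mem_Ici.2 (by linarith)) (by linarith)

/-- **For Lennard-Jones itself (equilibrium distance = contact distance) the octahedron beats the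
capped trigonal bipyramid.** [folklore] -/
theorem interactionEnergy_lennardJones_octahedralSix_lt :
    interactionEnergy (fun r : ℝ => lennardJones (r / 2)) octahedralSix <
      interactionEnergy (fun r : ℝ => lennardJones (r / 2)) cappedBipyramidSix :=
  interactionEnergy_octahedralSix_lt _ strictMonoOn_lennardJones_half

/-! ### The energy half at six balls -/

/-- **The octahedron is a sticky ground state among ALL six-ball packings, and the maximisers are
exactly the two macrostates** (from the discharged enumeration `ArkusHoy_sixSpheres_holds`).
[cite: HoyHarwayneGidanskyOHern2012, §2 (p. 4: "M(6,12) = 2 … N_c^max(6) = 12", Fig. 1)] -/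
theorem contactNumber_le_octahedralSix (z : Fin 6 → E3) (hz : Function.Injective z)
    (hp : IsUnitBallPacking (Set.range z)) :
    contactNumber z ≤ contactNumber octahedralSix ∧
      (contactNumber z = contactNumber octahedralSix →
        IsRelabelledCongruent z octahedralSix ∨ IsRelabelledCongruent z cappedBipyramidSix) := by
  rw [contactNumber_six.1]
  exact ArkusHoy_sixSpheres_holds.unrestricted z hz hp

/-! ### Close-packed nuclei attaining the enumerated maxima for `13 ≤ n ≤ 19` -/

/-- Integer model (fcc = `D₃ = {v ∈ ℤ³ : v₀ + v₁ + v₂ even}`, contact at squared distance `2`) of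
the centred cuboctahedron (labels `0–12`) followed by the six octahedral sites `±2e_k` capping its
square faces (labels `13–18`); the first `13 + k` labels form an fcc nucleus of `13 + k` balls,
`k = 6` being the `19`-ball octahedron of Bezdek's lower-bound construction ("the twelve vertices
of a cuboctahedron of edge length `2` … along with its center … have `36` contacts").
[cite: Bezdek2011, §1 and Theorem 1.1 (iii)] -/
def fcc19Int : Fin 19 → Fin 3 → ℤ :=
  ![![0, 0, 0],
    ![1, 1, 0], ![1, -1, 0], ![-1, 1, 0], ![-1, -1, 0],
    ![1, 0, 1], ![1, 0, -1], ![-1, 0, 1], ![-1, 0, -1],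
    ![0, 1, 1], ![0, 1, -1], ![0, -1, 1], ![0, -1, -1],
    ![2, 0, 0], ![-2, 0, 0], ![0, 2, 0], ![0, -2, 0], ![0, 0, 2], ![0, 0, -2]]

/-- The first `13 + k` labels of `fcc19Int` (`k ≤ 6`). [folklore] -/
def fccNucleusInt (k : Fin 7) : Fin (13 + k) → Fin 3 → ℤ :=
  fun i => fcc19Int (i.castLE (by omega))

/-- **The fcc nucleus of `13 + k` balls** (contact distance `2`): centred cuboctahedron plus `k`
square-face caps. [folklore] -/
def fccNucleus (k : Fin 7) : Fin (13 + k) → E3 :=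
  intConfig (fccNucleusInt k) (2 / Real.sqrt (2 : ℕ))

/-- All points of the model lie in the fcc lattice `D₃` (even coordinate sum): the nuclei are
close-packing fragments. [folklore] -/
theorem fcc19Int_even : ∀ i : Fin 19, 2 ∣ (fcc19Int i 0 + fcc19Int i 1 + fcc19Int i 2) := by
  decide

/-- Distinct points of each nucleus are at squared distance `≥ 2`. [folklore] -/
theorem sep_fccNucleus : ∀ k : Fin 7, ∀ i j : Fin (13 + k), i ≠ j →
    (2 : ℤ) ≤ sqNormInt (fccNucleusInt k i - fccNucleusInt k j) := by
  decide +kernel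

/-- Contact numbers `36 + 4k`: `12` radial and `24` cuboctahedral contacts, and `4` per cap.
[folklore] -/
theorem intContactNumber_fccNucleus :
    ∀ k : Fin 7, intContactNumber (fccNucleusInt k) 2 = 36 + 4 * k := by
  decide +kernel

/-- **Each fcc nucleus is a packing of unit balls with `36 + 4k` contacts** (`n = 13 + k ≤ 19`:
`36, 40, 44, 48, 52, 56, 60`). [folklore] -/
theorem fccNucleus_packing_contacts (k : Fin 7) :
    IsUnitBallPacking (Set.range (fccNucleus k)) ∧ contactNumber (fccNucleus k) = 36 + 4 * k := by
  refine ⟨isUnitBallPacking_scaled _ (by norm_num) (sep_fccNucleus k), ?_⟩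
  rw [fccNucleus, contactNumber_scaled _ (by norm_num : 0 < 2)]
  exact_mod_cast intContactNumber_fccNucleus k

/-! ### The narrowed barrier -/

/-- NARROWED BARRIER (audit 2026-08-15 of `StickySphereClusters`) — **six sticky balls refute
only the STRUCTURE half of a Heitmann–Radin transplant to `ℝ³` ("every maximal-contact packing
is a close-packing fragment, for every `N`"); the ENERGY half (a close-packing fragment attains
the maximal contact number) holds at six balls and on every enumeration in print, the local
(per-shell) sticky programme is untouched, and any strictly monotone tail lifts the six-ball tie —
toward the octahedron if increasing.** Clauses: (1) the parent `StickySphereClusters` (the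
octahedron and the capped trigonal bipyramid are non-congruent six-ball packings with `12`
contacts each, the latter a chain of three face-sharing regular tetrahedra); (2) among ALL packings
of six unit balls the octahedron's contact number `12` is maximal and is attained only by clusters
congruent up to relabelling to one of the two; (3) for `0 ≤ k ≤ 6` the fcc nucleus
`fccNucleus k` of `13 + k` balls is a unit-ball packing with `36 + 4k` contacts; (4) for every pair
potential `V`: strictly increasing on `[2, ∞)` ⇒ `𝓔_V(octahedron) < 𝓔_V(capped bipyramid)`,
strictly decreasing ⇒ the reverse, vanishing beyond `2` ⇒ equality, and the first case applies to
`r ↦ V_LJ(r/2)`.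

* technique_class: whole-cluster-structure-exactness-all-N (asserting, for the contact-counting energy in `ℝ³`, that for EVERY `N` EVERY maximal-contact `N`-ball packing is a fragment of a close packing — the second half of [cite: LucaFriesecke2016, Theorem 5.1] transplanted) seed-growth-classification-induction (inductions on `N` that grow Barlow seeds ball by ball and need all intermediate maximisers to stay Barlow) exactly-sticky-degeneracy-transfer (reading contact-degenerate sticky clusters as degenerate ground states of soft wells) — and NOT the parent's wider tokens `sticky-limit-exactness`, `contact-number-maximisation`, `brittle-limit-perturbation`, `close-packed-fragment-ansatz` in so far as they are used through maximal-contact VALUES, through the EXISTENCE of close-packed maximisers, PER SHELL (kissing configurations), asymptotically, or for potentials with a strictly monotone tail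
* blocks: ONLY the structure half, at the sizes where non-close-packed maximisers are in print: `N = 6` (typed: clause (1), with the complete list of clause (2)); `N = 7–9` (two of the `M_c = 15` seven-ball ground states are five-fold, "`f_Barlow` decreases rapidly for `N ≥ 7`" among isostatic = ground-state packings) [cite: HoyHarwayneGidanskyOHern2012, §3 and §3.2]; `n = 13` ("six other clusters with the same number of contacts, three of which have defects") and `n = 15, 16, 19` ("one ground state with a defect") [cite: HolmesCerfon2016, §3] — hence any induction on `N` through the full list of maximisers. NOT blocked: (a) the energy half — a close-packing fragment attains the maximal contact number at six balls (clause (2), proved) and at every enumerated `n ≤ 19` (`3n - 6` for `n ≤ 9` by capped octahedra and "every packing has exactly `3n - 6` contacts" [cite: ArkusManoharanBrenner2009, p. 2]; hcp subunits with `25, 29, 33` at `n = 10, 11, 12` [cite: ArkusManoharanBrenner2009, p. 2] [cite: HoyHarwayneGidanskyOHern2012, §3.1]; the fcc nuclei of clause (3) with `36 + 4k`, equal to the reported maxima for `13 ≤ n ≤ 19` [cite: HolmesCerfon2016, §3 and SI §7.5]); (b) the local programme — kissing number twelve and `≤ 24` tangencies with equality only for the cuboctahedron / twisted cuboctahedron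 [cite: FlatleyTheil2015, Theorems 3.4–3.5] [cite: FlatleyEtAl2013, Theorem], fcc crystallization for `α`-localized pair + three-body potentials [cite: FlatleyTheil2015, Theorem 1.1] with the pair-only case routed through a local conjecture [cite: FlatleyTheil2015, Conjecture 2.2], and Hales's kissing-twelve theorem (tree `Literature.Geometry.DiscreteGeometry.FejesTothKissingTwelve`) [cite: Hales2012, Theorem 1]; (c) soft wells at `N = 6` (clause (4): the tie is lifted toward the octahedron by any strictly increasing tail, e.g. Lennard-Jones at the contact scale); (d) the asymptotic conjecture, which tolerates finite-`N` degeneracy [cite: BlancLewin2015, §2.1 (15)–(17)]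
* because: the sticky energy is minus the contact number [cite: ArkusManoharanBrenner2009, p. 1]; the two six-ball maximisers and their completeness (`ArkusHoy_sixSpheres_holds`, discharging [cite: HoyHarwayneGidanskyOHern2012, §2 (p. 4, "M(6,12) = 2")]); for every `V` the six-ball energies are `12V(2) + 3V(2√2)` and `12V(2) + 2V(2√(8/3)) + V(10/3)` with `2 < 2√2 < 2√(8/3) < 10/3` (`interactionEnergy_octahedralSix`, `interactionEnergy_cappedBipyramidSix`); the fcc nuclei are explicit subsets of `D₃` (`fcc19Int_even`) with contact numbers by kernel computation; the `d = 3` local results quoted above classify twelve-point shells, not clusters [cite: FlatleyTheil2015, Proposition 3.3]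
* evasions_known: (a) use the sticky limit through `C(N)` or through ONE close-packed maximiser (clauses (2)–(3); `6n - ∛486 n^{2/3} < C_fcc(n) ≤ C(n) < 6n - 0.695 n^{2/3}` [cite: Bezdek2011, Theorem 1.1]); (b) go local: shells with `24` neighbour contacts are cuboctahedra / twisted cuboctahedra [cite: FlatleyEtAl2013, Theorem] [cite: FlatleyTheil2015, Theorem 3.5 and Proposition 3.3], packings with kissing number twelve are hexagonal-layer stackings [cite: Hales2012, Theorem 1] — their own obstructions are `KissingTwelveDegeneracy` (stacking not selected) and `FlexibleKissingArrangements` (soft wells); (c) add a three-body term [cite: FlatleyTheil2015, Theorem 1.1] ("of solely a technical nature" [cite: FlatleyTheil2015, remark after Theorem 1.1 (p. 4)]); (d) any strictly monotone tail lifts the six-ball degeneracy (clause (4)) — what soft wells add instead is five-fold order at `N = 7, 13` (`IcosahedralClusters`); (e) `d = 2` [cite: HeitmannRadin1980, Theorem] [cite: LucaFriesecke2016, Theorem 5.1]; (f) the asymptotic, local-limit form of the conjecture [cite: BlancLewin2015, §2.1 (15)–(17)]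
* scope_caveats: (a) typed and PROVED: clauses (1)–(4); (b) NOT typed, enumeration results only: that `36 + 4k` is maximal for `13 ≤ n ≤ 19` and `25, 29, 33` for `n = 10, 11, 12` ("we have no proof these sets are complete" [cite: HolmesCerfon2016, §1]; equality in `C(10) ≥ 25, …, C(13) ≥ 36` "is a challenging open question" [cite: Bezdek2011, §1]), and the non-Barlow maximisers at `n = 7–9, 13, 15, 16, 19`; rigorous here is `C(6) = 12` only; (c) "close-packing fragment" is formal only as membership of the models in `D₃` (fcc) and, for the octahedron, as the informal remark that it is the octahedral interstice of fcc/hcp; non-embeddability of the three-tetrahedra chain in Barlow stackings stays cited, not formalised (parent caveat); (d) open and untouched here: whether maximisers are eventually all Barlow ("appear to converge rapidly to close-packings" [cite: HolmesCerfon2016, §3]), `C(n)` in general (the combinatorial Kepler problem), stacking selection and periodicity of local limits (`KissingTwelveDegeneracy`), and everything about Lennard-Jones beyond clause (4) at `N = 6`; (e) the parent's "nearly 95% for `N = 11`" concerns isostatic second excited states, not ground states (unique, hcp) [cite: HoyHarwayneGidanskyOHern2012, §3.1 and §5]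
* status: established — `stickySphereClustersNarrow_holds` below (axioms `propext`, `Classical.choice`, `Quot.sound`); parent `StickySphereClusters_holds`; enumeration fact discharged (`ArkusHoy_sixSpheres_holds`); no dissent found on the cited enumerations (searches: sticky sphere ground states Barlow, contact numbers unit sphere packings, Holmes-Cerfon enumeration, Flatley–Theil fcc crystallization, "packing twelve spherical caps", galaxy `--star all`)

[cite: HoyHarwayneGidanskyOHern2012, §2–§3] [cite: HolmesCerfon2016, §3] [cite: FlatleyTheil2015, Theorem 1.1 and Theorem 3.5] -/
def StickySphereClustersNarrow : Prop :=
  StickySphereClusters ∧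
  (∀ z : Fin 6 → EuclideanSpace ℝ (Fin 3), Function.Injective z →
    IsUnitBallPacking (Set.range z) →
      contactNumber z ≤ contactNumber octahedralSix ∧
        (contactNumber z = contactNumber octahedralSix →
          IsRelabelledCongruent z octahedralSix ∨ IsRelabelledCongruent z cappedBipyramidSix)) ∧
  (∀ k : Fin 7, IsUnitBallPacking (Set.range (fccNucleus k)) ∧
    contactNumber (fccNucleus k) = 36 + 4 * k) ∧
  (∀ V : ℝ → ℝ, StrictMonoOn V (Set.Ici 2) →
    interactionEnergy V octahedralSix < interactionEnergy V cappedBipyramidSix) ∧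
  (∀ V : ℝ → ℝ, StrictAntiOn V (Set.Ici 2) →
    interactionEnergy V cappedBipyramidSix < interactionEnergy V octahedralSix) ∧
  (∀ V : ℝ → ℝ, (∀ r : ℝ, 2 < r → V r = 0) →
    interactionEnergy V octahedralSix = interactionEnergy V cappedBipyramidSix) ∧
  interactionEnergy (fun r : ℝ => lennardJones (r / 2)) octahedralSix <
    interactionEnergy (fun r : ℝ => lennardJones (r / 2)) cappedBipyramidSix

/-- **Proof of the narrowed barrier.** [cite: HoyHarwayneGidanskyOHern2012, §2 (p. 4)] -/
theorem stickySphereClustersNarrow_holds : StickySphereClustersNarrow :=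
  ⟨StickySphereClusters_holds, contactNumber_le_octahedralSix, fccNucleus_packing_contacts,
    interactionEnergy_octahedralSix_lt, interactionEnergy_cappedBipyramidSix_lt,
    interactionEnergy_eq_of_zero_tail, interactionEnergy_lennardJones_octahedralSix_lt⟩

/-- The narrowed entry implies the parent barrier. [folklore] -/
theorem StickySphereClustersNarrow.parent (h : StickySphereClustersNarrow) : StickySphereClusters :=
  h.1

end Literature.Barriers.AtomisticToContinuum

end
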